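import Literature.NumberTheory.LFunctions.RealCharacterDivisorSumsLevel
import Literature.NumberTheory.LFunctions.SiegelTheorem
import Literature.NumberTheory.Sieve.PolynomialValuesSieveBounds
import HarnessLib

/-!
# An upper-bound sieve for the primes `p` with `χ(p) = 1`:
# `∑_{z ≤ p ≤ x} (1 + χ(p)) ≤ C · x L(1,χ) ∏_{p<z} (1 − 1/p)(1 − χ(p)/p) + 5q √x z³`

Topic `Literature/NumberTheory/Sieve`. Everything is PROVED. For a quadratic Dirichlet character
`χ ≠ χ₀` mod `q` the non-negative multiplicative sequence `r = χ ∗ 1` (`r(p) = 1 + χ(p)`,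
`Literature.NumberTheory.LFunctions.RealChar.charDivisorSum`) is a sifted sequence in the sense
of the tree's framework (`Literature.NumberTheory.Sieve.SieveSequence`): by
`RealCharacterDivisorSumsLevel.lean`,
`A_d(x) = ∑_{n ≤ x, d ∣ n} r(n) = g(d) L(1,χ) x + R_d(x)`, `|R_d(x)| ≤ 5q√x τ(d)²/√d`, with the
multiplicative density `g`, `1 − g(p) = (1 − 1/p)(1 − χ(p)/p)`.

* `charDivisorSeq χ hq` — the sifted sequence (`a = r`, `X(x) = L(1,χ) x`, density `g`);
* `hasSieveDimension_charDivisorDensity` — `g` has sieve dimension `2` with the absolute constant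
  `4 e^{17 + 12/log 2}` (`(1 − g(p))⁻¹ ≤ (1 − 1/p)⁻² ≤ [p = 2] 4, (1 − 2/p)⁻¹` and Mertens over
  windows, exactly as `hasSieveDimension_rootDensity`);
* `sum_abs_remainder_charDivisorSeq_le` — the crude remainder bound
  `∑_{d ∣ P(z), d ≤ D} |R_d(x)| ≤ 5 q √x D³`;
* `sum_primes_one_add_reChar_le` — **the sieve bound**: for `2 ≤ z ≤ x`,
  `∑_{z ≤ p ≤ x, p prime} (1 + χ(p)) ≤ (1 + C₂) L(1,χ) x ∏_{p<z} (1 − 1/p)(1 − χ(p)/p) + 5 q √x z³`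
  with `C₂ = flConst 2 (4e^{17+12/log 2})`, the constant of the tree's Fundamental Lemma
  (`SieveSequence.fundamental_lemma_explicit`, used with level `D = z`): the primes in `[z, x]`
  survive sifting by `P(z)` and carry the weight `r(p) = 1 + χ(p)`.

Combined with `L(1,χ) ∏_{p<z}(1 − χ(p)/p) ≪ 1/η` in the presence of an exceptional zero
`β = 1 − 1/(η log q)` (`ExceptionalZeroLOneBound.lean`), this is the sparsity of the primes with
`χ(p) = 1` in `[q^C, q^η]` used by Granville–Mollin (*Rabinowitsch revisited*, §5C) and
Tao–Teräväinen (2021, §3), obtained here by sieve instead of the explicit formula.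

## References

* H. Halberstam, H.-E. Richert, *Sieve Methods* (1974), Thm 2.5 (Fundamental Lemma).
  [HalberstamRichert1974]
* A. Granville, R. A. Mollin, *Rabinowitsch revisited*, Acta Arith. 96 (2000), §5C.
  [GranvilleMollin2000]
-/

noncomputable section

open Finset Real ArithmeticFunction

namespace Literature.NumberTheory.Sieve

open Literature.NumberTheory.LFunctions.RealChar Literature.NumberTheory.LFunctions.DirichletAbel

variable {q : ℕ} [NeZero q] (χ : DirichletCharacter ℂ q)

/-! ### The sifted sequence `r = χ ∗ 1` -/

/-- The sifted sequence of `r = χ ∗ 1` for a quadratic character `χ`: weights `a_n = r(n) ≥ 0`,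
size `X(x) = L(1, χ) x`, density `g = charDivisorDensity χ` (multiplicative,
`1 − g(p) = (1 − 1/p)(1 − χ(p)/p)`). [folklore] -/
def charDivisorSeq (hq : χ ^ 2 = 1) : SieveSequence where
  a n := charDivisorSum χ n
  a_nonneg := charDivisorSum_nonneg χ hq
  size x := (χ.LFunction 1).re * x
  density := charDivisorDensity χ
  density_mult := isMultiplicative_charDivisorDensity χ hq

/-- Unfolding: the remainder of `charDivisorSeq` is `A_d(x) − g(d) L(1,χ) x`. [folklore] -/
theorem charDivisorSeq_remainder (hq : χ ^ 2 = 1) (d : ℕ) (x : ℝ) :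
    (charDivisorSeq χ hq).remainder d x =
      ∑ n ∈ (Ioc 0 ⌊x⌋₊).filter (d ∣ ·), charDivisorSum χ n -
        charDivisorDensity χ d * ((χ.LFunction 1).re * x) := rfl

/-- Unfolding: `V(P(z)) = ∏_{p<z} (1 − 1/p)(1 − χ(p)/p)` for `charDivisorSeq`. [folklore] -/
theorem charDivisorSeq_densityProduct (hq : χ ^ 2 = 1) (z : ℝ) :
    (charDivisorSeq χ hq).densityProduct (primesProdBelow z) =
      ∏ p ∈ Nat.primesBelow ⌈z⌉₊, (1 - (p : ℝ)⁻¹) * (1 - reChar χ p / p) := by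
  rw [SieveSequence.densityProduct, primeFactors_primesProdBelow]
  exact prod_congr rfl fun p hp => one_sub_charDivisorDensity_prime χ hq (Nat.prime_of_mem_primesBelow hp)

/-- Unfolding: the sifting function of `charDivisorSeq` is `∑_{n ≤ x, (n, P) = 1} r(n)`. [folklore] -/
theorem charDivisorSeq_sifted (hq : χ ^ 2 = 1) (x : ℝ) (P : ℕ) :
    (charDivisorSeq χ hq).sifted x P =
      ∑ n ∈ (Ioc 0 ⌊x⌋₊).filter (fun n : ℕ => n.Coprime P), charDivisorSum χ n := rfl

/-! ### Dimension `2` -/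

omit [NeZero q] in
/-- At a prime: `0 ≤ g(p) < 1` and `(1 − g(p))⁻¹ ≤ ((1 − 1/p)⁻¹)²` (since `χ(p) ∈ {0, ±1}` gives
`(1 − 1/p)² ≤ 1 − g(p) = (1 − 1/p)(1 − χ(p)/p) ≤ 1 − 1/p²`). [folklore] -/
theorem charDivisorDensity_prime_bounds (hq : χ ^ 2 = 1) {p : ℕ} (hp : p.Prime) :
    0 ≤ charDivisorDensity χ p ∧ charDivisorDensity χ p < 1 ∧
      (1 - charDivisorDensity χ p)⁻¹ ≤ ((1 - (p : ℝ)⁻¹)⁻¹) ^ 2 := by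
  have h1g := one_sub_charDivisorDensity_prime χ hq hp
  have hp2 : (2 : ℝ) ≤ p := by exact_mod_cast hp.two_le
  have hp0 : (0 : ℝ) < p := by linarith
  have hpinv : (p : ℝ)⁻¹ ≤ 1 / 2 := by rw [inv_le_comm₀ hp0 (by norm_num)]; linarith
  have hA : (1 : ℝ) / 2 ≤ 1 - (p : ℝ)⁻¹ := by linarith
  have hpinv0 : 0 < (p : ℝ)⁻¹ := inv_pos.mpr hp0
  -- `1 - 1/p ≤ 1 - χ(p)/p ≤ 1 + 1/p`
  have hB1 : 1 - (p : ℝ)⁻¹ ≤ 1 - reChar χ p / p ∧ 1 - reChar χ p / p ≤ 1 + (p : ℝ)⁻¹ := by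
    rcases reChar_trichotomy χ hq p with h | h | h <;> rw [h] <;>
      constructor <;> simp [div_eq_mul_inv] <;> linarith
  obtain ⟨hB1, hB2⟩ := hB1
  have hlow : (1 - (p : ℝ)⁻¹) ^ 2 ≤ 1 - charDivisorDensity χ p := by
    rw [h1g, sq]; exact mul_le_mul_of_nonneg_left hB1 (by linarith)
  have hupp : 1 - charDivisorDensity χ p ≤ 1 - (p : ℝ)⁻¹ ^ 2 := by
    rw [h1g]
    calc (1 - (p : ℝ)⁻¹) * (1 - reChar χ p / p) ≤ (1 - (p : ℝ)⁻¹) * (1 + (p : ℝ)⁻¹) :=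
          mul_le_mul_of_nonneg_left hB2 (by linarith)
      _ = 1 - (p : ℝ)⁻¹ ^ 2 := by ring
  have hsqpos : 0 < (1 - (p : ℝ)⁻¹) ^ 2 := by positivity
  refine ⟨?_, ?_, ?_⟩
  · nlinarith [sq_nonneg ((p : ℝ)⁻¹)]
  · linarith
  · rw [inv_pow]
    exact inv_anti₀ hsqpos hlow

omit [NeZero q] in
/-- **The density `g` of `r = χ ∗ 1` has sieve dimension `2`** with the absolute constant
`4 e^{17 + 12/log 2}`: `∏_{w ≤ p < z} (1 − g(p))⁻¹ ≤ 4e^{17+12/log 2} (log z/log w)²` for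
`2 ≤ w ≤ z` (termwise `(1 − g(p))⁻¹ ≤ (1 − 1/p)⁻² ≤ [p = 2] 4 · exp(2/p + 8/(p(p−1)))` and
Mertens over the window, as in `hasSieveDimension_rootDensity`). [cite: HalberstamRichert1974, Ch. 2 (Ω₂(κ))] -/
theorem hasSieveDimension_charDivisorDensity (hq : χ ^ 2 = 1) :
    HasSieveDimension (charDivisorDensity χ) 2 (4 * Real.exp (17 + 12 / Real.log 2)) := by
  have hg : ∀ p : ℕ, p.Prime → 0 ≤ charDivisorDensity χ p ∧ charDivisorDensity χ p < 1 :=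
    fun p hp => ⟨(charDivisorDensity_prime_bounds χ hq hp).1, (charDivisorDensity_prime_bounds χ hq hp).2.1⟩
  refine ⟨hg, fun w z hw hwz => ?_⟩
  set S := (Nat.primesBelow ⌈z⌉₊).filter (fun p : ℕ => w ≤ (p : ℝ)) with hS
  have hlogw : 0 < Real.log w := Real.log_pos (by linarith)
  have hlogz : 0 < Real.log z := Real.log_pos (by linarith)
  have hmemS : ∀ p ∈ S, p.Prime ∧ w ≤ (p : ℝ) ∧ p ≤ ⌊z⌋₊ := by
    intro p hp
    rw [hS, Finset.mem_filter, Nat.mem_primesBelow] at hp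
    exact ⟨hp.1.2, hp.2, Nat.le_floor (Nat.lt_ceil.mp hp.1.1).le⟩
  have hSle : S ⊆ Nat.primesLE ⌊z⌋₊ := fun p hp =>
    Nat.mem_primesLE.mpr ⟨(hmemS p hp).2.2, (hmemS p hp).1⟩
  set F : ℕ → ℝ := fun p => Real.exp (2 / (p : ℝ) + 8 * (1 / ((p : ℝ) * ((p : ℝ) - 1)))) with hF
  have hF1 : ∀ p ∈ S, 1 ≤ F p := fun p hp => by
    have hp2 : (2 : ℝ) ≤ p := by exact_mod_cast (hmemS p hp).1.two_le
    have : (0 : ℝ) < (p : ℝ) * ((p : ℝ) - 1) := mul_pos (by linarith) (by linarith)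
    exact Real.one_le_exp (by positivity)
  have hpt : ∀ p ∈ S, (1 - charDivisorDensity χ p)⁻¹ ≤ (if p = 2 then (4 : ℝ) else 1) * F p := by
    intro p hp
    have hpp := (hmemS p hp).1
    have hb := (charDivisorDensity_prime_bounds χ hq hpp).2.2
    refine hb.trans ?_
    by_cases hp2 : p = 2
    · subst hp2
      rw [if_pos rfl]
      calc ((1 - ((2 : ℕ) : ℝ)⁻¹)⁻¹) ^ 2 = 4 := by norm_num
        _ ≤ 4 * F 2 := le_mul_of_one_le_right (by norm_num) (hF1 2 hp)
    · rw [if_neg hp2, one_mul]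
      have hp3 : 3 ≤ p := by have := hpp.two_le; omega
      have hp3' : (3 : ℝ) ≤ p := by exact_mod_cast hp3
      have hp0 : (0 : ℝ) < p := by linarith
      -- `(1 - 1/p)⁻² ≤ (1 - 2/p)⁻¹`
      have hkey : ((1 - (p : ℝ)⁻¹)⁻¹) ^ 2 ≤ (1 - 2 / (p : ℝ))⁻¹ := by
        rw [inv_pow]
        apply inv_anti₀ (by rw [sub_pos, div_lt_one hp0]; linarith)
        have : (1 - (p : ℝ)⁻¹) ^ 2 = 1 - 2 / p + ((p : ℝ)⁻¹) ^ 2 := by field_simp; ring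
        rw [this]
        nlinarith [sq_nonneg ((p : ℝ)⁻¹)]
      exact hkey.trans (Lichtman2020.inv_one_sub_two_div_le_exp hp3')
  have hnonneg : ∀ p ∈ S, 0 ≤ (1 - charDivisorDensity χ p)⁻¹ := fun p hp =>
    inv_nonneg.mpr (sub_nonneg.mpr (hg p (hmemS p hp).1).2.le)
  have hsum1 : ∑ p ∈ S, (1 : ℝ) / p ≤
      Real.log (Real.log z) - Real.log (Real.log w) + (9 / 2 + 6 / Real.log 2) :=
    sum_primesWindow_one_div_le hw hwz
  have hsum2 : ∑ p ∈ S, (1 : ℝ) / (p * (p - 1)) ≤ 1 :=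
    (Finset.sum_le_sum_of_subset_of_nonneg hSle fun p hp _ => by
      have hp2 : (2 : ℝ) ≤ p := by exact_mod_cast (Nat.mem_primesLE.mp hp).2.two_le
      have : (0 : ℝ) < p * (p - 1) := mul_pos (by linarith) (by linarith)
      positivity).trans
      (Literature.NumberTheory.LFunctions.MertensBound.sum_inv_prime_mul_pred_le_one ⌊z⌋₊)
  have hprod2 : ∏ p ∈ S, (if p = 2 then (4 : ℝ) else 1) ≤ 4 := by
    have : ∏ p ∈ S, (if p = 2 then (4 : ℝ) else 1) = if 2 ∈ S then 4 else 1 :=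
      Finset.prod_ite_eq' S 2 (fun _ => (4 : ℝ))
    rw [this]
    split_ifs <;> norm_num
  have hE : Real.exp (Real.log (Real.log z) - Real.log (Real.log w)) = Real.log z / Real.log w := by
    rw [Real.exp_sub, Real.exp_log hlogz, Real.exp_log hlogw]
  calc ∏ p ∈ S, (1 - charDivisorDensity χ p)⁻¹
      ≤ ∏ p ∈ S, ((if p = 2 then (4 : ℝ) else 1) * F p) := Finset.prod_le_prod hnonneg hpt
    _ = (∏ p ∈ S, (if p = 2 then (4 : ℝ) else 1)) * ∏ p ∈ S, F p := Finset.prod_mul_distrib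
    _ ≤ 4 * ∏ p ∈ S, F p :=
        mul_le_mul_of_nonneg_right hprod2 (Finset.prod_nonneg fun p _ => (Real.exp_pos _).le)
    _ = 4 * Real.exp (∑ p ∈ S, (2 / (p : ℝ) + 8 * (1 / ((p : ℝ) * ((p : ℝ) - 1))))) := by
        rw [hF, Real.exp_sum]
    _ = 4 * Real.exp (2 * ∑ p ∈ S, 1 / (p : ℝ) + 8 * ∑ p ∈ S, 1 / ((p : ℝ) * ((p : ℝ) - 1))) := by
        rw [Finset.sum_add_distrib, Finset.mul_sum, Finset.mul_sum]
        congr 3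
        refine Finset.sum_congr rfl fun p _ => ?_
        rw [mul_one_div]
    _ ≤ 4 * Real.exp (2 * (Real.log (Real.log z) - Real.log (Real.log w) + (9 / 2 + 6 / Real.log 2))
          + 8 * 1) :=
        mul_le_mul_of_nonneg_left (Real.exp_le_exp.mpr (by linarith)) (by norm_num)
    _ = 4 * Real.exp ((17 + 12 / Real.log 2) +
          ((Real.log (Real.log z) - Real.log (Real.log w)) +
            (Real.log (Real.log z) - Real.log (Real.log w)))) := by
        congr 2; ring
    _ = (4 * Real.exp (17 + 12 / Real.log 2)) * (Real.log z / Real.log w) ^ (2 : ℝ) := by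
        rw [Real.exp_add (17 + 12 / Real.log 2),
          Real.exp_add (Real.log (Real.log z) - Real.log (Real.log w)), hE, Real.rpow_two]
        ring

/-! ### The remainder sum -/

/-- **Crude remainder bound**: for quadratic `χ ≠ χ₀` mod `q`, `x > 0`, `D ≥ 0` and any `z`,
`∑_{d ∣ P(z), d ≤ D} |R_d(x)| ≤ 5 q √x D³` (each term is `≤ 5q√x τ(d)²/√d ≤ 5q√x D²`, and there
are at most `D` of them). [folklore] -/
theorem sum_abs_remainder_charDivisorSeq_le (hχ : χ ≠ 1) (hq : χ ^ 2 = 1) {x D : ℝ} (hx : 0 < x)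
    (hD : 0 ≤ D) (z : ℝ) :
    ∑ d ∈ (primesProdBelow z).divisors.filter (fun d : ℕ => (d : ℝ) ≤ D),
        |(charDivisorSeq χ hq).remainder d x| ≤ 5 * q * Real.sqrt x * D ^ 3 := by
  set T := (primesProdBelow z).divisors.filter (fun d : ℕ => (d : ℝ) ≤ D) with hT
  have hsq : Squarefree (primesProdBelow z) := squarefree_primesProdBelow z
  have hterm : ∀ d ∈ T, |(charDivisorSeq χ hq).remainder d x| ≤ 5 * q * Real.sqrt x * D ^ 2 := by
    intro d hd
    rw [hT, Finset.mem_filter] at hd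
    obtain ⟨hdd, hdD⟩ := hd
    have hd0 : d ≠ 0 := Nat.ne_of_gt (Nat.pos_of_mem_divisors hdd)
    have hd1 : (1 : ℝ) ≤ d := by exact_mod_cast Nat.pos_of_ne_zero hd0
    have hdsq : Squarefree d := hsq.squarefree_of_dvd (Nat.dvd_of_mem_divisors hdd)
    rw [charDivisorSeq_remainder]
    refine (abs_congrSum_charDivisorSum_sub_le χ hχ hq hdsq hx).trans ?_
    have hτ : (#d.divisors : ℝ) ≤ d := by exact_mod_cast Nat.card_divisors_le_self d
    have hτD : (#d.divisors : ℝ) ^ 2 ≤ D ^ 2 := by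
      have h0 : (0 : ℝ) ≤ #d.divisors := Nat.cast_nonneg _
      nlinarith
    have hsd : 1 ≤ Real.sqrt d := Real.one_le_sqrt.mpr hd1
    have hpos : 0 ≤ 5 * q * Real.sqrt x := by positivity
    calc 5 * q * Real.sqrt x * (#d.divisors : ℝ) ^ 2 / Real.sqrt d
        ≤ 5 * q * Real.sqrt x * (#d.divisors : ℝ) ^ 2 / 1 :=
          div_le_div_of_nonneg_left (by positivity) one_pos hsd
      _ ≤ 5 * q * Real.sqrt x * D ^ 2 := by rw [div_one]; exact mul_le_mul_of_nonneg_left hτD hpos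
  have hcard : (#T : ℝ) ≤ D := by
    have hsub : T ⊆ Finset.Icc 1 ⌊D⌋₊ := by
      intro d hd
      rw [hT, Finset.mem_filter] at hd
      rw [Finset.mem_Icc]
      exact ⟨Nat.pos_of_mem_divisors hd.1, Nat.le_floor hd.2⟩
    calc (#T : ℝ) ≤ #(Finset.Icc 1 ⌊D⌋₊) := by exact_mod_cast Finset.card_le_card hsub
      _ = ⌊D⌋₊ := by rw [Nat.card_Icc]; push_cast; ring
      _ ≤ D := Nat.floor_le hD
  calc ∑ d ∈ T, |(charDivisorSeq χ hq).remainder d x| ≤ ∑ _d ∈ T, 5 * q * Real.sqrt x * D ^ 2 :=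
        Finset.sum_le_sum hterm
    _ = #T * (5 * q * Real.sqrt x * D ^ 2) := by rw [Finset.sum_const, nsmul_eq_mul]
    _ ≤ D * (5 * q * Real.sqrt x * D ^ 2) := mul_le_mul_of_nonneg_right hcard (by positivity)
    _ = 5 * q * Real.sqrt x * D ^ 3 := by ring

/-! ### The sieve bound -/

/-- The primes of `[z, x]` survive sifting by `P(z)` and carry the weight `r(p) = 1 + χ(p)`:
`∑_{z ≤ p ≤ x} (1 + χ(p)) ≤ S(𝒜, P(z); x)` for `𝒜 = charDivisorSeq`. [folklore] -/
theorem sum_primes_one_add_reChar_le_sifted (hq : χ ^ 2 = 1) (x z : ℝ) :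
    ∑ p ∈ (Nat.primesLE ⌊x⌋₊).filter (fun p : ℕ => z ≤ (p : ℝ)), (1 + reChar χ p) ≤
      (charDivisorSeq χ hq).sifted x (primesProdBelow z) := by
  rw [charDivisorSeq_sifted]
  have hsub : (Nat.primesLE ⌊x⌋₊).filter (fun p : ℕ => z ≤ (p : ℝ)) ⊆
      (Ioc 0 ⌊x⌋₊).filter (fun n : ℕ => n.Coprime (primesProdBelow z)) := by
    intro p hp
    rw [Finset.mem_filter, Nat.mem_primesLE] at hp
    obtain ⟨⟨hpx, hpp⟩, hzp⟩ := hp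
    rw [Finset.mem_filter, Finset.mem_Ioc]
    refine ⟨⟨hpp.pos, hpx⟩, ?_⟩
    rw [coprime_primesProdBelow_iff]
    intro r hr hrp
    rw [Nat.mem_primesBelow] at hr
    have hr1 : r ≠ 1 := hr.2.ne_one
    have hrp' : r = p := ((Nat.dvd_prime hpp).mp hrp).resolve_left hr1
    have : (r : ℝ) < z := Nat.lt_ceil.mp hr.1
    rw [hrp'] at this
    linarith
  calc ∑ p ∈ (Nat.primesLE ⌊x⌋₊).filter (fun p : ℕ => z ≤ (p : ℝ)), (1 + reChar χ p)
      = ∑ p ∈ (Nat.primesLE ⌊x⌋₊).filter (fun p : ℕ => z ≤ (p : ℝ)), charDivisorSum χ p := by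
        refine Finset.sum_congr rfl fun p hp => ?_
        rw [Finset.mem_filter, Nat.mem_primesLE] at hp
        exact (charDivisorSum_prime χ hq hp.1.2).symm
    _ ≤ _ := Finset.sum_le_sum_of_subset_of_nonneg hsub fun n _ _ => charDivisorSum_nonneg χ hq n

/-- **Upper-bound sieve for the primes with `χ(p) = 1`.** For a quadratic character `χ ≠ χ₀`
mod `q` and `2 ≤ z ≤ x`:
`∑_{z ≤ p ≤ x, p prime} (1 + χ(p)) ≤ (1 + C₂) · L(1,χ) x ∏_{p<z} (1 − 1/p)(1 − χ(p)/p) + 5 q √x z³`,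
`C₂ = flConst 2 (4e^{17+12/log 2})` (the tree's Fundamental Lemma at level `D = z` for the
sifted sequence `r = χ ∗ 1`, plus the crude remainder bound).
[cite: HalberstamRichert1974, Thm 2.5] -/
theorem sum_primes_one_add_reChar_le (hχ : χ ≠ 1) (hq : χ ^ 2 = 1) {x z : ℝ} (hz : 2 ≤ z)
    (hzx : z ≤ x) :
    ∑ p ∈ (Nat.primesLE ⌊x⌋₊).filter (fun p : ℕ => z ≤ (p : ℝ)), (1 + reChar χ p) ≤
      (1 + SieveSequence.flConst 2 (4 * Real.exp (17 + 12 / Real.log 2))) *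
          ((χ.LFunction 1).re * x *
            ∏ p ∈ Nat.primesBelow ⌈z⌉₊, (1 - (p : ℝ)⁻¹) * (1 - reChar χ p / p)) +
        5 * q * Real.sqrt x * z ^ 3 := by
  set A := charDivisorSeq χ hq with hA
  set K : ℝ := 4 * Real.exp (17 + 12 / Real.log 2) with hK
  have hx : 0 < x := by linarith
  have hdim : HasSieveDimension A.density 2 K := hasSieveDimension_charDivisorDensity χ hq
  have hL : 0 < (χ.LFunction 1).re := Literature.NumberTheory.LFunctions.Siegel.LFunction_one_re_pos χ hχ hq
  have hX : 0 ≤ A.size x := by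
    change 0 ≤ (χ.LFunction 1).re * x
    positivity
  have hFL := SieveSequence.fundamental_lemma_explicit hdim (by norm_num : (0 : ℝ) < 2) hz le_rfl hX
  have hR : ∑ d ∈ (primesProdBelow z).divisors.filter (fun d : ℕ => (d : ℝ) ≤ z),
      |A.remainder d x| ≤ 5 * q * Real.sqrt x * z ^ 3 :=
    sum_abs_remainder_charDivisorSeq_le χ hχ hq hx (by linarith : (0 : ℝ) ≤ z) z
  have hlow : ∑ p ∈ (Nat.primesLE ⌊x⌋₊).filter (fun p : ℕ => z ≤ (p : ℝ)), (1 + reChar χ p) ≤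
      A.sifted x (primesProdBelow z) := sum_primes_one_add_reChar_le_sifted χ hq x z
  have hV : A.densityProduct (primesProdBelow z) =
      ∏ p ∈ Nat.primesBelow ⌈z⌉₊, (1 - (p : ℝ)⁻¹) * (1 - reChar χ p / p) :=
    charDivisorSeq_densityProduct χ hq z
  have hsize : A.size x = (χ.LFunction 1).re * x := rfl
  have hV0 : 0 < A.densityProduct (primesProdBelow z) :=
    SieveSequence.densityProduct_pos_of_dim hdim _
  have hXV : 0 ≤ A.size x * A.densityProduct (primesProdBelow z) := mul_nonneg hX hV0.le
  have hC0 : 0 < SieveSequence.flConst 2 K := SieveSequence.flConst_pos (by norm_num) (by positivity)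
  have hexp : Real.exp (-(Real.log z / Real.log z)) ≤ 1 := by
    rw [Real.exp_le_one_iff, neg_nonpos]
    exact div_nonneg (Real.log_nonneg (by linarith)) (Real.log_nonneg (by linarith))
  have h1 : SieveSequence.flConst 2 K * A.size x * A.densityProduct (primesProdBelow z) *
      Real.exp (-(Real.log z / Real.log z)) ≤
      SieveSequence.flConst 2 K * A.size x * A.densityProduct (primesProdBelow z) := by
    refine mul_le_of_le_one_right ?_ hexp
    have := mul_nonneg hC0.le hXV
    linarith [mul_assoc (SieveSequence.flConst 2 K) (A.size x) (A.densityProduct (primesProdBelow z))]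
  have h2 := (abs_le.mp hFL).2
  rw [hV, hsize] at h1 h2 hXV
  nlinarith

end Literature.NumberTheory.Sieve
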